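import Literature.Combinatorics.StablePolynomials.Basic
import Mathlib.RingTheory.MvPolynomial.Homogeneous
import Mathlib.Analysis.Complex.Basic
import Mathlib.Data.List.TFAE
import HarnessLib

/-!
# The two-vector criterion for stability of a homogeneous polynomial (Choe–Oxley–Sokal–Wagner, Prop. 5.2)

Y.-B. Choe, J. G. Oxley, A. D. Sokal, D. G. Wagner, *Homogeneous multivariate polynomials with the half-plane
property*, Adv. Appl. Math. 32 (2004) 88–187 (arXiv:math/0202034), §5.1:

> **Proposition 5.2.** Let `P` be a homogeneous degree-`r` polynomial in `n` complex variables. For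
> `x, y ∈ ℝⁿ`, define the univariate polynomial `p_{x,y}(ζ) = P(ζx + y)`. Then the following are equivalent:
> (a) `P` has the half-plane property and is not identically zero. (b) For all `x, y ≥ 0` with `x + y > 0`,
> all the roots (real or complex) of `p_{x,y}` lie in `(−∞, 0]`. (c) For all `x, y > 0`, all the roots (real
> or complex) of `p_{x,y}` lie in `(−∞, 0]`.

Conventions. COSW's half-plane property refers to the open *right* half-plane; the tree's
`IsUpperHalfPlaneStable` (`Literature.Combinatorics.StablePolynomials.Basic`) to the open *upper* half-plane.
For a *homogeneous* `P` the two are equivalent (`P(iz) = i^r P(z)`), and clauses (b), (c) are insensitive to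
the choice; we state the proposition for `IsUpperHalfPlaneStable`. "`x ≥ 0`, `x + y > 0`" are coordinatewise.
The value `p_{x,y}(ζ)` is written `MvPolynomial.eval (fun i => ζ * x i + y i) P`, and "all roots lie in
`(−∞, 0]`" as `p_{x,y}(ζ) = 0 → ζ.im = 0 ∧ ζ.re ≤ 0` (for the zero polynomial this fails, matching "not
identically zero" in (a)).

## Main results (namespace `Literature.Combinatorics.StablePolynomials`)

* `IsUpperHalfPlaneStable.im_eq_zero_and_re_nonpos_of_eval_two_vectors` — **(a) ⇒ (b)**: with
  `β = i(|ζ| + ζ̄)`, `α = βζ` (both in `H` when `ζ ∉ (−∞,0]`), `P(αx + βy) = β^r p_{x,y}(ζ) ≠ 0`.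
* `isUpperHalfPlaneStable_of_two_vectors` — **(c) ⇒ (a)**: a point `z ∈ Hⁿ` is `αx + βy` with
  `α = −M + i`, `β = M + i`, `x, y > 0` for `M` large, and `α/β ∉ ℝ`.
* `isUpperHalfPlaneStable_tfae_two_vectors` — the three clauses as `List.TFAE`;
  `isRealStable_tfae_two_vectors` — the same for a real form (`IsRealStable`).

## References

* [ChoeOxleySokalWagner2004] Y.-B. Choe, J. G. Oxley, A. D. Sokal, D. G. Wagner, Adv. Appl. Math. 32 (2004)
  88–187; arXiv:math/0202034: §5.1, Prop. 5.2 with proof (arXiv p. 20).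
-/

noncomputable section

open MvPolynomial
open scoped ComplexConjugate

namespace Literature.Combinatorics.StablePolynomials

variable {σ : Type*} {P : MvPolynomial σ ℂ} {r : ℕ}

/-- `F(c • v) = c^r F(v)` for a form of degree `r`. [folklore] -/
private theorem eval_smul_eq_pow_mul_hom {F : MvPolynomial σ ℂ} {n : ℕ} (hF : F.IsHomogeneous n) (c : ℂ)
    (v : σ → ℂ) : eval (c • v) F = c ^ n * eval v F := by
  rw [eval_eq, eval_eq, Finset.mul_sum]
  refine Finset.sum_congr rfl fun m hm => ?_
  simp only [Pi.smul_apply, smul_eq_mul, mul_pow, Finset.prod_mul_distrib, Finset.prod_pow_eq_pow_sum,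
    ← hF.degree_eq_sum_deg_support hm]
  ring

/-! ## (a) ⇒ (b) -/

/-- **COSW Prop. 5.2, (a) ⇒ (b)**: if the form `P` is (upper half-plane) stable, then for all real vectors
`x, y ≥ 0` with `x + y > 0` every zero `ζ` of `p_{x,y}(ζ) = P(ζx + y)` is real and `≤ 0` ("If
`ζ₀ ∈ ℂ ∖ (−∞,0]`, then we can find `α, β ∈ H` such that `α/β = ζ₀`. But this means that
`p_{x,y}(α/β) = β^{-r} P(αx + βy) ≠ 0`"; here `β = i(|ζ| + ζ̄)`, `α = βζ`).
[cite: ChoeOxleySokalWagner2004, §5.1 Prop. 5.2 ((a) ⇒ (b))] -/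
theorem IsUpperHalfPlaneStable.im_eq_zero_and_re_nonpos_of_eval_two_vectors (hp : IsUpperHalfPlaneStable P)
    (hhom : P.IsHomogeneous r) {x y : σ → ℝ} (hx : ∀ i, 0 ≤ x i) (hy : ∀ i, 0 ≤ y i)
    (hxy : ∀ i, 0 < x i + y i) {ζ : ℂ} (h0 : eval (fun i => ζ * x i + y i) P = 0) :
    ζ.im = 0 ∧ ζ.re ≤ 0 := by
  by_contra hcon
  -- `ζ ∉ (-∞, 0]` means `Re ζ + |ζ| > 0`
  have hkey : 0 < ζ.re + ‖ζ‖ := by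
    by_cases him : ζ.im = 0
    · have hre : 0 < ζ.re := by
        by_contra hre
        exact hcon ⟨him, not_lt.1 hre⟩
      linarith [norm_nonneg ζ]
    · have h := Complex.abs_re_lt_norm.2 him
      linarith [neg_abs_le ζ.re]
  have hζ0 : ζ ≠ 0 := by
    rintro rfl
    exact hcon ⟨rfl, le_rfl⟩
  -- the multiplier `β = i(|ζ| + ζ̄)` and `α = βζ`
  set β : ℂ := Complex.I * ((‖ζ‖ : ℂ) + conj ζ) with hβ
  have hβim : β.im = ‖ζ‖ + ζ.re := by
    simp [hβ, Complex.mul_im]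
  have hβζ : β * ζ = Complex.I * ((‖ζ‖ : ℂ) * ζ + (‖ζ‖ : ℂ) ^ 2) := by
    rw [hβ, mul_assoc, add_mul, Complex.conj_mul']
  have hβζim : (β * ζ).im = ‖ζ‖ * (ζ.re + ‖ζ‖) := by
    rw [hβζ]
    simp [Complex.mul_im, sq]
    ring
  have hβim_pos : 0 < β.im := by rw [hβim]; linarith
  have hβζim_pos : 0 < (β * ζ).im := by rw [hβζim]; exact mul_pos (norm_pos_iff.2 hζ0) hkey
  -- the point `β(ζ x + y) = (βζ) x + β y ∈ Hⁿ`
  have hpt : ∀ i, 0 < ((β • fun i => ζ * (x i : ℂ) + (y i : ℂ)) i).im := by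
    intro i
    have hform : (β • fun i => ζ * (x i : ℂ) + (y i : ℂ)) i = (β * ζ) * (x i : ℂ) + β * (y i : ℂ) := by
      simp only [Pi.smul_apply, smul_eq_mul]
      ring
    rw [hform, Complex.add_im, Complex.im_mul_ofReal, Complex.im_mul_ofReal]
    rcases (hx i).eq_or_lt with hxi | hxi
    · have hyi : 0 < y i := by linarith [hxy i]
      rw [← hxi, mul_zero, zero_add]
      exact mul_pos hβim_pos hyi
    · exact add_pos_of_pos_of_nonneg (mul_pos hβζim_pos hxi) (mul_nonneg hβim_pos.le (hy i))
  refine hp _ hpt ?_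
  rw [eval_smul_eq_pow_mul_hom hhom, h0, mul_zero]

/-! ## (c) ⇒ (a) -/

/-- **COSW Prop. 5.2, (c) ⇒ (a)**: if for all `x, y > 0` every zero of `ζ ↦ P(ζx + y)` lies in `(−∞, 0]`,
then the form `P` is (upper half-plane) stable. ("Choose `α, β ∈ H` in such a way that all the `zᵢ` lie in
the interior of the convex cone generated by `α` and `β` … Then `P(z) = P(αx + βy) = β^r p_{x,y}(α/β) ≠ 0`";
here `α = −M + i`, `β = M + i` with `M > Σᵢ |Re zᵢ| / Im zᵢ`, so that `zᵢ = α xᵢ + β yᵢ` with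
`xᵢ, yᵢ > 0`, and `α/β` is not real.) [cite: ChoeOxleySokalWagner2004, §5.1 Prop. 5.2 ((c) ⇒ (a))] -/
theorem isUpperHalfPlaneStable_of_two_vectors [Fintype σ] (hhom : P.IsHomogeneous r)
    (h : ∀ x y : σ → ℝ, (∀ i, 0 < x i) → (∀ i, 0 < y i) →
      ∀ ζ : ℂ, eval (fun i => ζ * x i + y i) P = 0 → ζ.im = 0 ∧ ζ.re ≤ 0) :
    IsUpperHalfPlaneStable P := by
  intro z hz hPz
  -- a large parameter `M`
  set S : ℝ := ∑ j, |(z j).re| / (z j).im with hS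
  have hS0 : 0 ≤ S := Finset.sum_nonneg fun j _ => div_nonneg (abs_nonneg _) (hz j).le
  set M : ℝ := 1 + S with hM
  have hM0 : 0 < M := by positivity
  have hMz : ∀ j, |(z j).re| < M * (z j).im := by
    intro j
    have h3 : |(z j).re| / (z j).im ≤ S :=
      Finset.single_le_sum (f := fun i => |(z i).re| / (z i).im)
        (fun i _ => div_nonneg (abs_nonneg _) (hz i).le) (Finset.mem_univ j)
    have h4 : |(z j).re| ≤ S * (z j).im := (div_le_iff₀ (hz j)).1 h3
    nlinarith [hz j]
  -- `α = -M + i`, `β = M + i`, `x = (Im z - Re z / M)/2`, `y = (Im z + Re z / M)/2`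
  set α : ℂ := -(M : ℂ) + Complex.I with hα
  set β : ℂ := (M : ℂ) + Complex.I with hβdef
  set x : σ → ℝ := fun j => ((z j).im - (z j).re / M) / 2 with hx
  set y : σ → ℝ := fun j => ((z j).im + (z j).re / M) / 2 with hy
  have hxpos : ∀ j, 0 < x j := by
    intro j
    have h1 : (z j).re / M < (z j).im := by
      rw [div_lt_iff₀ hM0]
      linarith [le_abs_self (z j).re, hMz j, mul_comm M (z j).im]
    simp only [hx]
    linarith
  have hypos : ∀ j, 0 < y j := by
    intro j
    have h1 : -(z j).im < (z j).re / M := by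
      rw [lt_div_iff₀ hM0]
      linarith [neg_abs_le (z j).re, hMz j, mul_comm M (z j).im]
    simp only [hy]
    linarith
  have hβ0 : β ≠ 0 := fun h0 => by
    have := congrArg Complex.im h0
    simp [hβdef] at this
  -- `z = α x + β y = β (ζ x + y)` with `ζ = α / β`
  have hzj : ∀ j, z j = β * ((α / β) * (x j : ℂ) + (y j : ℂ)) := by
    intro j
    rw [mul_add, ← mul_assoc, mul_div_cancel₀ _ hβ0]
    apply Complex.ext
    · simp only [hα, hβdef, hx, hy, Complex.add_re, Complex.mul_re, Complex.neg_re, Complex.ofReal_re,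
        Complex.I_re, Complex.neg_im, Complex.ofReal_im, Complex.I_im, Complex.add_im]
      field_simp
      ring
    · simp only [hα, hβdef, hx, hy, Complex.add_im, Complex.mul_im, Complex.neg_re, Complex.ofReal_re,
        Complex.I_re, Complex.neg_im, Complex.ofReal_im, Complex.I_im, Complex.add_re]
      field_simp
      ring
  have hzeq : z = β • fun j => (α / β) * (x j : ℂ) + (y j : ℂ) := by
    funext j
    rw [Pi.smul_apply, smul_eq_mul]
    exact hzj j
  rw [hzeq, eval_smul_eq_pow_mul_hom hhom] at hPz
  have hev : eval (fun j => (α / β) * (x j : ℂ) + (y j : ℂ)) P = 0 :=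
    (mul_eq_zero.1 hPz).resolve_left (pow_ne_zero _ hβ0)
  have him := (h x y hxpos hypos (α / β) hev).1
  -- but `α / β = (1 - M² + 2Mi)/(M² + 1)` is not real
  have hquot : (α / β).im = 2 * M / (M ^ 2 + 1) := by
    have hne : (M : ℂ) ^ 2 + 1 ≠ 0 := by
      intro h0
      have := congrArg Complex.re h0
      simp [sq] at this
      nlinarith
    rw [Complex.div_im]
    simp only [hα, hβdef, Complex.add_re, Complex.neg_re, Complex.ofReal_re, Complex.I_re, Complex.add_im,
      Complex.neg_im, Complex.ofReal_im, Complex.I_im, Complex.normSq_apply]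
    field_simp
    ring
  rw [hquot] at him
  have : (0 : ℝ) < 2 * M / (M ^ 2 + 1) := by positivity
  linarith

/-! ## The equivalence -/

/-- **COSW Proposition 5.2 (the two-vector criterion), all three clauses**, for a form `P` (stated for upper
half-plane stability, which for forms is equivalent to COSW's right half-plane property).
[cite: ChoeOxleySokalWagner2004, §5.1 Prop. 5.2] -/
theorem isUpperHalfPlaneStable_tfae_two_vectors [Fintype σ] (hhom : P.IsHomogeneous r) :
    List.TFAE [IsUpperHalfPlaneStable P,
      ∀ x y : σ → ℝ, (∀ i, 0 ≤ x i) → (∀ i, 0 ≤ y i) → (∀ i, 0 < x i + y i) →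
        ∀ ζ : ℂ, eval (fun i => ζ * x i + y i) P = 0 → ζ.im = 0 ∧ ζ.re ≤ 0,
      ∀ x y : σ → ℝ, (∀ i, 0 < x i) → (∀ i, 0 < y i) →
        ∀ ζ : ℂ, eval (fun i => ζ * x i + y i) P = 0 → ζ.im = 0 ∧ ζ.re ≤ 0] := by
  tfae_have 1 → 2 := fun hp x y hx hy hxy ζ h0 =>
    hp.im_eq_zero_and_re_nonpos_of_eval_two_vectors hhom hx hy hxy h0
  tfae_have 2 → 3 := fun h x y hx hy ζ h0 =>
    h x y (fun i => (hx i).le) (fun i => (hy i).le) (fun i => add_pos (hx i) (hy i)) ζ h0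
  tfae_have 3 → 1 := fun h => isUpperHalfPlaneStable_of_two_vectors hhom h
  tfae_finish

/-- **COSW Prop. 5.2 for a real form** (`IsRealStable f`, i.e. stability of the complexification): `f` is
real stable iff for all `x, y > 0` (resp. `x, y ≥ 0`, `x + y > 0`) every zero of `ζ ↦ f(ζx + y)` is real
and `≤ 0`. [cite: ChoeOxleySokalWagner2004, §5.1 Prop. 5.2] -/
theorem isRealStable_tfae_two_vectors [Fintype σ] {f : MvPolynomial σ ℝ} (hhom : f.IsHomogeneous r) :
    List.TFAE [IsRealStable f,
      ∀ x y : σ → ℝ, (∀ i, 0 ≤ x i) → (∀ i, 0 ≤ y i) → (∀ i, 0 < x i + y i) →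
        ∀ ζ : ℂ, eval (fun i => ζ * x i + y i) (map (algebraMap ℝ ℂ) f) = 0 → ζ.im = 0 ∧ ζ.re ≤ 0,
      ∀ x y : σ → ℝ, (∀ i, 0 < x i) → (∀ i, 0 < y i) →
        ∀ ζ : ℂ, eval (fun i => ζ * x i + y i) (map (algebraMap ℝ ℂ) f) = 0 → ζ.im = 0 ∧ ζ.re ≤ 0] :=
  isUpperHalfPlaneStable_tfae_two_vectors (hhom.map (algebraMap ℝ ℂ))

end Literature.Combinatorics.StablePolynomials
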